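import Literature.Probability.LatticeModels.KilledWalkLaplacian
import Literature.Probability.LatticeModels.BoundaryPoleGreenBounds
import Literature.Probability.LatticeModels.DomainDiscretisation
import Literature.Probability.Percolation.BoxCrossingProofs
import Literature.Topology.PlaneTopology.RectangleDuality
import HarnessLib

/-!
# Harnack's inequality for the edge-killed walk in clean boxes

Topic `Literature/Probability/LatticeModels` (continuation of `KilledWalkLaplacian.lean` and
`BoundaryPoleGreenBounds.lean`). Inside a lattice box all of whose edges are kept by the graph
`Gr`, a function harmonic for the edge-killed walk is lattice-harmonic, so the interior Harnack
inequality `harnack_box` applies (`harnack_box_killed`: `h ≥ (c_*/2) h(c)` on `mB c k` for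
`h ≥ 0` killed-harmonic on `mW c k`). For the walk `Ω^δ = discreteDomainGraph D δ` of a domain
the cleanliness hypothesis holds as soon as the closed box of radius `(48k+1)δ` about the mesh
point of `c` lies in `D` and `c ∈ Ω_δ` (`forall_adj_of_box_subset`): the domain version
`harnack_meshBox`. Chains of such boxes give `harnack_chain`-type comparisons for the
killed walk (`harnack_chain_killed`).

Everything is proved. [cite: Chelkak2016, Proposition 2.7 (Harnack); LawlerLimic2010, Thm. 6.3.9]
-/

noncomputable section

namespace Literature.Probability.LatticeModels

open Set SimpleGraph
open scoped Classical

variable {Gr : SimpleGraph (Site 2)}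

/-! ### Harnack in a clean box -/

/-- **Harnack's inequality for the edge-killed walk in a clean box.** If every lattice edge at
every site of `mW c k` is a `Gr`-edge and `h ≥ 0` is killed-harmonic on `mW c k`, then
`(c_*/2) h c ≤ h x` for `x ∈ mB c k`. [folklore] -/
theorem harnack_box_killed (c : Site 2) {k : ℕ} (hk : 0 < k)
    (hclean : ∀ v ∈ mW c k, ∀ e : SRW.Dir 2, Gr.Adj v (v + SRW.stepVec e))
    {h : Site 2 → ℝ} (hh : IsKilledHarmonicOn Gr h (mW c k)) (hpos : ∀ w, 0 ≤ h w)
    {x : Site 2} (hx : x ∈ mB c k) : maneuverConst / 2 * h c ≤ h x :=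
  harnack_box c hk ((isKilledHarmonicOn_iff_isLatticeHarmonicOn hclean).1 hh) hpos hx

/-- **Harnack chain for the edge-killed walk.** Along centres `c₀, …, c_J` with `c_{j+1} ∈ mB (c j) k`,
all boxes `mW (c j) k` clean and `h ≥ 0` killed-harmonic on each of them:
`h (c J) ≥ (c_*/2)^J h (c 0)`. [folklore] -/
theorem harnack_chain_killed {h : Site 2 → ℝ} (hpos : ∀ w, 0 ≤ h w) {k : ℕ} (hk : 0 < k) (c : ℕ → Site 2) :
    ∀ J : ℕ, (∀ j, j ≤ J → ∀ v ∈ mW (c j) k, ∀ e : SRW.Dir 2, Gr.Adj v (v + SRW.stepVec e)) →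
      (∀ j, j ≤ J → IsKilledHarmonicOn Gr h (mW (c j) k)) → (∀ j, j < J → c (j + 1) ∈ mB (c j) k) →
      (maneuverConst / 2) ^ J * h (c 0) ≤ h (c J) := by
  intro J hclean hharm hstep
  exact harnack_chain hpos hk c J
    (fun j hj => (isKilledHarmonicOn_iff_isLatticeHarmonicOn (hclean j hj)).1 (hharm j hj)) hstep

/-! ### Cleanliness of boxes inside the domain -/

section Domain

open Literature.Probability.Percolation (mem_meshDomain_of_meshGraph_adj)

variable {Ω : Set ℂ} {δ : ℝ}

/-- The closed lattice box of sup-radius `n` about `c`, read on the mesh, as a real set condition: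
`|z.re/δ - c₀| ≤ n ∧ |z.im/δ - c₁| ≤ n`. We use it only through the hypothesis
`realBox ⊆ Ω`. [folklore] -/
def meshBox (δ : ℝ) (c : Site 2) (n : ℝ) : Set ℂ := {z | |z.re / δ - c 0| ≤ n ∧ |z.im / δ - c 1| ≤ n}

/-- The mesh point of a site within lattice sup-distance `n` of `c` lies in `meshBox δ c n`. [folklore] -/
theorem meshPoint_mem_meshBox (hδ : 0 < δ) {c v : Site 2} {n : ℝ} (h0 : ((|v 0 - c 0| : ℤ) : ℝ) ≤ n)
    (h1 : ((|v 1 - c 1| : ℤ) : ℝ) ≤ n) : meshPoint δ v ∈ meshBox δ c n := by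
  simp only [meshBox, Set.mem_setOf_eq, meshPoint_re, meshPoint_im]
  rw [mul_div_cancel_left₀ _ hδ.ne', mul_div_cancel_left₀ _ hδ.ne']
  push_cast at h0 h1
  exact ⟨h0, h1⟩

/-- `meshBox` as a product of intervals (for `δ > 0`). [folklore] -/
theorem meshBox_eq_reProdIm (hδ : 0 < δ) (c : Site 2) (n : ℝ) :
    meshBox δ c n = Icc (δ * (c 0 - n)) (δ * (c 0 + n)) ×ℂ Icc (δ * (c 1 - n)) (δ * (c 1 + n)) := by
  ext z
  simp only [meshBox, Set.mem_setOf_eq, Complex.mem_reProdIm, Set.mem_Icc, abs_le]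
  have key : ∀ (t : ℝ) (m : ℤ), (-n ≤ t / δ - m ∧ t / δ - m ≤ n) ↔ (δ * (m - n) ≤ t ∧ t ≤ δ * (m + n)) := by
    intro t m
    rw [show t / δ - m = (t - δ * m) / δ by field_simp, le_div_iff₀ hδ, div_le_iff₀ hδ]
    constructor <;> rintro ⟨h1, h2⟩ <;> constructor <;> nlinarith
  rw [key, key]

/-- `meshBox` is convex. [folklore] -/
theorem convex_meshBox (hδ : 0 < δ) (c : Site 2) (n : ℝ) : Convex ℝ (meshBox δ c n) := by
  rw [meshBox_eq_reProdIm hδ]; exact Literature.Topology.PlaneTopology.convex_Icc_reProdIm_Icc _ _ _ _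

/-- **Cleanliness of a lattice box inside the domain.** If the mesh box of sup-radius `N + 1`
about `c` lies in `Ω` and `c ∈ Ω_δ`, then every site within lattice sup-distance `N` of `c` has
all four of its lattice edges in `Ω^δ = discreteDomainGraph Ω δ` (and lies in `Ω_δ`). [folklore] -/
theorem forall_adj_of_meshBox_subset (hδ : 0 < δ) {c : Site 2} {N : ℕ}
    (hbox : meshBox δ c (N + 1) ⊆ Ω) (hc : c ∈ meshDomain Ω δ) :
    ∀ v : Site 2, |v 0 - c 0| ≤ N → |v 1 - c 1| ≤ N →
      v ∈ meshDomain Ω δ ∧ ∀ e : SRW.Dir 2, (discreteDomainGraph Ω δ).Adj v (v + SRW.stepVec e) := by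
  -- mesh points of sites within sup-distance `N + 1` are in `Ω`
  have hvert : ∀ w : Site 2, |w 0 - c 0| ≤ N + 1 → |w 1 - c 1| ≤ N + 1 → w ∈ meshVertices Ω δ := by
    intro w h0 h1
    exact hbox (meshPoint_mem_meshBox hδ (by exact_mod_cast h0) (by exact_mod_cast h1))
  -- kept edges between such sites
  have hkept : ∀ w w' : Site 2, |w 0 - c 0| ≤ N + 1 → |w 1 - c 1| ≤ N + 1 → |w' 0 - c 0| ≤ N + 1 → |w' 1 - c 1| ≤ N + 1 →
      (zdGraph 2).Adj w w' → (meshGraph Ω δ).Adj w w' := by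
    intro w w' h0 h1 h0' h1' hadj
    refine meshGraph_adj_iff.2 ⟨hadj, (subset_closure.trans' hbox).trans' ?_⟩
    exact (convex_meshBox hδ c _).segment_subset (meshPoint_mem_meshBox hδ (by exact_mod_cast h0) (by exact_mod_cast h1))
      (meshPoint_mem_meshBox hδ (by exact_mod_cast h0') (by exact_mod_cast h1'))
  -- membership in `Ω_δ` propagates from `c` along kept edges: induction on the lattice distance
  have hmem : ∀ n : ℕ, ∀ v : Site 2, |v 0 - c 0| ≤ N + 1 → |v 1 - c 1| ≤ N + 1 →
      (|v 0 - c 0| + |v 1 - c 1|).toNat ≤ n → v ∈ meshDomain Ω δ := by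
    intro n
    induction n with
    | zero =>
      intro v h0 h1 hn
      have ha := abs_nonneg (v 0 - c 0)
      have hb := abs_nonneg (v 1 - c 1)
      have hsum : |v 0 - c 0| + |v 1 - c 1| ≤ 0 := by
        have := Int.toNat_eq_zero.1 (Nat.le_zero.1 hn); omega
      have hv : v = c := by
        have e0 : |v 0 - c 0| = 0 := by omega
        have e1 : |v 1 - c 1| = 0 := by omega
        rw [abs_eq_zero, sub_eq_zero] at e0 e1
        ext i; fin_cases i
        · exact e0
        · exact e1
      rw [hv]; exact hc
    | succ n ih =>
      intro v h0 h1 hn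
      have ha := abs_nonneg (v 0 - c 0)
      have hb := abs_nonneg (v 1 - c 1)
      by_cases hvc : |v 0 - c 0| + |v 1 - c 1| ≤ n
      · exact ih v h0 h1 (by omega)
      · -- a neighbour `w` of `v` one step closer to `c`
        obtain ⟨w, hw0, hw1, hwd, hadj⟩ : ∃ w : Site 2, |w 0 - c 0| ≤ N + 1 ∧ |w 1 - c 1| ≤ N + 1 ∧
            |w 0 - c 0| + |w 1 - c 1| + 1 = |v 0 - c 0| + |v 1 - c 1| ∧ (zdGraph 2).Adj w v := by
          by_cases hx : v 0 ≠ c 0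
          · -- move the first coordinate towards `c 0`
            rcases lt_or_gt_of_ne hx with hlt | hgt
            · refine ⟨v + SRW.stepVec ((0, true) : SRW.Dir 2), ?_, ?_, ?_, ?_⟩
              · simp [SRW.stepVec, abs_le] at h0 ⊢; constructor <;> omega
              · simpa [SRW.stepVec] using h1
              · simp [SRW.stepVec]
                have e1 : |v 0 + 1 - c 0| + 1 = |v 0 - c 0| := by
                  rw [abs_of_nonpos (by omega), abs_of_neg (by omega)]; ring
                omega
              · have := (zdGraph_adj_add_stepVec v ((0, true) : SRW.Dir 2)).symm; exact this
            · refine ⟨v + SRW.stepVec ((0, false) : SRW.Dir 2), ?_, ?_, ?_, ?_⟩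
              · simp [SRW.stepVec, abs_le] at h0 ⊢; constructor <;> omega
              · simpa [SRW.stepVec] using h1
              · simp [SRW.stepVec]
                have e1 : |v 0 + -1 - c 0| + 1 = |v 0 - c 0| := by
                  rw [abs_of_nonneg (by omega), abs_of_pos (by omega)]; ring
                omega
              · have := (zdGraph_adj_add_stepVec v ((0, false) : SRW.Dir 2)).symm; exact this
          · push Not at hx
            have hy : v 1 ≠ c 1 := by
              intro hy; apply hvc; rw [hx, hy]; simp
            rcases lt_or_gt_of_ne hy with hlt | hgt
            · refine ⟨v + SRW.stepVec ((1, true) : SRW.Dir 2), ?_, ?_, ?_, ?_⟩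
              · simpa [SRW.stepVec] using h0
              · simp [SRW.stepVec, abs_le] at h1 ⊢; constructor <;> omega
              · simp [SRW.stepVec]
                have e1 : |v 1 + 1 - c 1| + 1 = |v 1 - c 1| := by
                  rw [abs_of_nonpos (by omega), abs_of_neg (by omega)]; ring
                omega
              · have := (zdGraph_adj_add_stepVec v ((1, true) : SRW.Dir 2)).symm; exact this
            · refine ⟨v + SRW.stepVec ((1, false) : SRW.Dir 2), ?_, ?_, ?_, ?_⟩
              · simpa [SRW.stepVec] using h0
              · simp [SRW.stepVec, abs_le] at h1 ⊢; constructor <;> omega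
              · simp [SRW.stepVec]
                have e1 : |v 1 + -1 - c 1| + 1 = |v 1 - c 1| := by
                  rw [abs_of_nonneg (by omega), abs_of_pos (by omega)]; ring
                omega
              · have := (zdGraph_adj_add_stepVec v ((1, false) : SRW.Dir 2)).symm; exact this
        have hwa := abs_nonneg (w 0 - c 0)
        have hwb := abs_nonneg (w 1 - c 1)
        have hwmem : w ∈ meshDomain Ω δ := ih w hw0 hw1 (by omega)
        exact mem_meshDomain_of_meshGraph_adj hwmem (hvert v h0 h1) (hkept w v hw0 hw1 h0 h1 hadj)
  intro v h0 h1
  have h0' : |v 0 - c 0| ≤ N + 1 := by omega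
  have h1' : |v 1 - c 1| ≤ N + 1 := by omega
  have hv : v ∈ meshDomain Ω δ := hmem _ v h0' h1' le_rfl
  refine ⟨hv, fun e => ?_⟩
  have he0 := SRW.abs_stepVec_apply_le e 0
  have he1 := SRW.abs_stepVec_apply_le e 1
  have hw0 : |(v + SRW.stepVec e) 0 - c 0| ≤ N + 1 := by
    simp only [Pi.add_apply]; rw [abs_le] at h0 he0 ⊢; constructor <;> omega
  have hw1 : |(v + SRW.stepVec e) 1 - c 1| ≤ N + 1 := by
    simp only [Pi.add_apply]; rw [abs_le] at h1 he1 ⊢; constructor <;> omega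
  have hmg : (meshGraph Ω δ).Adj v (v + SRW.stepVec e) := hkept v _ h0' h1' hw0 hw1 (zdGraph_adj_add_stepVec v e)
  exact discreteDomainGraph_adj_iff.2 ⟨hmg, hv, mem_meshDomain_of_meshGraph_adj hv (hvert _ hw0 hw1) hmg⟩

/-- **Harnack for `Ω^δ` in a box inside the domain.** If the mesh box of sup-radius `48k + 2`
about `c` lies in `Ω`, `c ∈ Ω_δ`, and `h ≥ 0` is harmonic for the edge-killed walk `Ω^δ` on
`mW c k`, then `(c_*/2) h c ≤ h x` on `mB c k`. [folklore] -/
theorem harnack_meshBox (hδ : 0 < δ) {c : Site 2} {k : ℕ} (hk : 0 < k)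
    (hbox : meshBox δ c ((48 * k + 1 : ℕ) + 1) ⊆ Ω) (hc : c ∈ meshDomain Ω δ)
    {h : Site 2 → ℝ} (hh : IsKilledHarmonicOn (discreteDomainGraph Ω δ) h (mW c k)) (hpos : ∀ w, 0 ≤ h w)
    {x : Site 2} (hx : x ∈ mB c k) : maneuverConst / 2 * h c ≤ h x := by
  refine harnack_box_killed c hk (fun v hv e => ?_) hh hpos hx
  obtain ⟨h0, h1⟩ := hv
  exact (forall_adj_of_meshBox_subset hδ hbox hc v (h0.trans (by push_cast; omega)) (h1.trans (by push_cast; omega))).2 e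

end Domain

end Literature.Probability.LatticeModels
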